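import Summits.QuantumAdvantage.QuantumAdvantage.Theses.CompactnessLift
import Literature.Computability.Complexity.TimeBoundsProofs
import Literature.Computability.Complexity.UnaryArithMachines

/-!
# `CompactnessPrinciple` (crux stmt-QuantumAdvantage-15270, route `CompactnessLift`) — negative-side
# support: the registered stub `stub_fuelledClock` of line `coin-padding-slices` is FALSE as typed

The strategist line `Cruxes/CompactnessPrinciple/Lines/coin_padding_slices.lean`
(planner-cstrat-stmt-QuantumAdvantage-15270-b1-0, 2026-08-17, sha `5bcc6a49…`) registers the stub

  `stub_fuelledClock : ∀ p B : Polynomial ℕ, ∃ a, TimeComputable id id (clockFn p B) (fun n => a * n + a)`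

with `clockFn p B w = 1^{p |x|} 0 w` if `B |x| ≤ |r|` (where `(x, r) = boolUnpair w`), else `[]`:

  `clockFn p B w = if B.eval |(boolUnpair w).1| ≤ |(boolUnpair w).2| then ones (p.eval |(boolUnpair w).1|) ++ false :: w else []`

(this file states everything with that body INLINED — `stub_fuelledClock_false` below is, character
for character, `¬` the stub after `unfold clockFn` — so that no definition is introduced here).
The quantifier ranges over ALL budget polynomials `B` — in particular `B = 0`, where the fuel guard
`0 ≤ |r|` always passes. Then the output has length `p |x| + 1 + |w|`, which for `p = X²` and
`w = ⟨1^N, []⟩` (`|w| = 2N + 2`) is QUADRATIC in `|w|`; but a Mathlib-`TM2` machine halting within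
`m` steps leaves at most `|w| + D · m` symbols on its output stack
(`Turing.TM2ComputableAux.OutputsWithin.length_le`, `D = machinePushBound`: one step runs one
`Stmt` tree, hence pushes `≤ D` symbols). So no machine computes `clockFn X² 0` within `a |w| + a`
steps (`not_timeComputable_clock_sq_zero`, witness `N = 3 · D · a + 3`), and the stub is false
(`stub_fuelledClock_false`).

CLASS: stub-misstated (NOT a refutation of the crux, which follows from `BPP ⊆ ⋃ₖ BPTIME(nᵏ)`,
`Cruxes/CompactnessPrinciple/Disproof.lean`, `compactnessPrinciple_of_H1`). REPAIR — the line
survives: its assembly (`preimage_mem_DTIME_id`) instantiates the stub only at `B = budget p c' k`,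
and `p ≤ budget p c' k` pointwise (`eval_budget`), so the intended stub is

  `∀ p B : Polynomial ℕ, (∀ n, p.eval n ≤ B.eval n) →
      ∃ a, TimeComputable id id (clockFn p B) (fun n => a * n + a)`;

under that side condition the output is linear-size on EVERY input
(`length_clock_le_of_forall_eval_le`: `|clockFn p B w| ≤ 2 |w| + 1`), so this file's witness misses
the repaired stub. Sorry-free.
-/

noncomputable section

set_option linter.dupNamespace false

namespace Summit.QuantumAdvantage.QuantumAdvantage.Theorems.CompactnessPrinciple.Negative

open Polynomial Turing
open Literature.Computability.Complexity Literature.Computability.Complexity.TM2Comp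

/-- **No machine computes `clockFn X² 0` in linear time**: with budget `B = 0` the guard always
passes, and on `w = ⟨1^N, []⟩` the output has length `N² + 2N + 3`, while `a |w| + a` steps push at
most `D (a |w| + a)` symbols (`OutputsWithin.length_le`). [folklore] -/
theorem not_timeComputable_clock_sq_zero (a : ℕ) :
    ¬ TimeComputable id id
        (fun w : List Bool =>
          if (0 : Polynomial ℕ).eval (boolUnpair w).1.length ≤ (boolUnpair w).2.length then
            ones ((X ^ 2 : Polynomial ℕ).eval (boolUnpair w).1.length) ++ false :: w
          else [])
        fun n => a * n + a := by
  rintro ⟨M, hM⟩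
  have h := (hM (boolPair (List.replicate (3 * (machinePushBound M.tm * a) + 3) true) [])).length_le
  simp only [id, eval_zero, zero_le, if_true, boolUnpair_boolPair, List.length_replicate, eval_pow,
    eval_X, List.length_append, List.length_cons, length_boolPair, List.length_nil] at h
  generalize hN : 3 * (machinePushBound M.tm * a) + 3 = N at h
  have key : N ^ 2 ≤ machinePushBound M.tm * a * (2 * N + 3) := by linarith
  generalize machinePushBound M.tm * a = t at key hN
  subst hN
  nlinarith [key, Nat.zero_le t]

/-- **`stub_fuelledClock` (line `coin-padding-slices`) is false as typed** — `¬ ∀ p B, ∃ a,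
TimeComputable id id (clockFn p B) (a · n + a)` with `clockFn` unfolded; witness `p := X²`,
`B := 0`. [folklore] -/
theorem stub_fuelledClock_false :
    ¬ ∀ p B : Polynomial ℕ, ∃ a : ℕ, TimeComputable id id
        (fun w : List Bool =>
          if B.eval (boolUnpair w).1.length ≤ (boolUnpair w).2.length then
            ones (p.eval (boolUnpair w).1.length) ++ false :: w
          else [])
        fun n => a * n + a := by
  intro h
  obtain ⟨a, ha⟩ := h (X ^ 2) 0
  exact not_timeComputable_clock_sq_zero a ha

/-- **The witness misses the repaired stub**: under the side condition `p ≤ B` (pointwise) the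
clock's output is linear-size on every input, `|clockFn p B w| ≤ 2 |w| + 1` (guard passed:
`p |x| ≤ B |x| ≤ |r|` and `2 |x| + |r| ≤ |w|`, `length_boolUnpair_parts_le`). [folklore] -/
theorem length_clock_le_of_forall_eval_le {p B : Polynomial ℕ} (hpB : ∀ n, p.eval n ≤ B.eval n)
    (w : List Bool) :
    (if B.eval (boolUnpair w).1.length ≤ (boolUnpair w).2.length then
        ones (p.eval (boolUnpair w).1.length) ++ false :: w
      else []).length ≤ 2 * w.length + 1 := by
  split_ifs with h
  · have hw := length_boolUnpair_parts_le w
    have hp := hpB (boolUnpair w).1.length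
    simp only [List.length_append, List.length_replicate, List.length_cons]
    omega
  · simp

end Summit.QuantumAdvantage.QuantumAdvantage.Theorems.CompactnessPrinciple.Negative
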